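import Summits.KontsevichZagierPeriods.KontsevichZagierPeriods.Theorems.HurwitzMicroSectorsNormalFormPrincipleLevelOne
import Summits.KontsevichZagierPeriods.KontsevichZagierPeriods.Theorems.HurwitzMicroSectorsNormalFormPrincipleSlabASubPtK20
import Summits.KontsevichZagierPeriods.KontsevichZagierPeriods.Theorems.HurwitzMicroSectorsNormalFormPrincipleAlgCarriers
import Summits.KontsevichZagierPeriods.KontsevichZagierPeriods.Theorems.HurwitzMicroSectorsNormalFormPrincipleM2FiveZetaTwo

/-!
# `NormalFormPrinciple` (stmt-KontsevichZagierPeriods-3869), line `SketchIdeator1` — leaf `stub_boxRigidity`: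
# level one with real-algebraic coefficients: the representations of the pipeline exist

Registered sub-goal `alg_exists_reps` of the layer `AlgLevelOne` (level one `[(0,1)², P/(1 − xy)]`
with `P ∈ (ℚ̄ ∩ ℝ)[x,y]`). For a real algebraic coefficient `c` (`IsAlgebraic ℚ c`) the five shapes
of honest Kontsevich–Zagier integral representations met along the level-one pipeline exist, with
LITERAL domains and integrands:

* the level-one monomial box `[(0,1)², c·x₀^a x₁^b/(1 − x₀x₁)]` (seat c7's `exists_levelOneRep`
  with the constant `c` factored out: `ℚ`-semialgebraic by `isSemialgebraicFunOn_const_of_isAlgebraic`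
  and the product rule, integrable by Beukers' integral for `ζ(2)`);
* the triangle `[{0 < z₀ < 1, 0 ≤ z₁ ≤ z₀}, c·z₀^{a−b−1} z₁^b/(1 − z₁)]` (seat c7's
  `exists_triangleRep`, whose absolute convergence was transported through the merge chart
  `(x₀, x₁) ↦ (x₀, x₀x₁)`; here the real constant is factored out of the case `c = 1`);
* the dimension-one polynomial box `[(0,1), (c/k)·x₀^b Σ_{i<k} x₀^i]` and the diagonal monomial box
  `[(0,1)², c·(x₀x₁)^i]` (polynomial integrands: continuous on the compact cube `[0,1]ᵐ ⊇ (0,1)ᵐ`);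
* the algebraic point `[pt, c]` (`Dlog.exists_ptCarrierA`).

References: M. Kontsevich, D. Zagier, *Periods* (2001), §1.1–1.2; F. Beukers, *A note on the
irrationality of ζ(2) and ζ(3)*, Bull. LMS 11 (1979). No new definitions.
-/

noncomputable section

open MeasureTheory Set
open Literature.NumberTheory.Transcendental Literature.NumberTheory.Transcendental.KZ
open Literature.ModelTheory.ExponentialFields (IsSemialgebraic)

namespace Summit.KontsevichZagierPeriods.HurwitzMicroSectors.NormalFormPrinciple.PiBox.AlgLevelOne

/-! ## The level-one monomial box -/

/-- **Semialgebraicity of the level-one monomial integrand with an algebraic coefficient.**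
`x ↦ c·x₀^a x₁^b/(1 − x₀x₁)` is `ℚ`-semialgebraic on the open unit box for real algebraic `c`: the
constant `c` is `ℚ`-semialgebraic (`isSemialgebraicFunOn_const_of_isAlgebraic`) and so is the
rational part `x₀^a x₁^b/(1 − x₀x₁)` (seat c7). [cite: KontsevichZagier2001, §1.1] -/
theorem isSemialgebraicFunOn_monomialBoxIntegrandA (a b : ℕ) {c : ℝ} (hc : IsAlgebraic ℚ c) :
    IsSemialgebraicFunOn ℚ {x : Fin 2 → ℝ | ∀ i, x i ∈ Set.Ioo (0:ℝ) 1}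
      (fun x => c * (x 0 ^ a * x 1 ^ b) / (1 - x 0 * x 1)) := by
  refine (IsSemialgebraicFunOn.mul_holds
    (isSemialgebraicFunOn_const_of_isAlgebraic (isSemialgebraic_box 2) hc)
    (LevelOne.isSemialgebraicFunOn_aeval_div_one_sub_mul
      (MvPolynomial.X 0 ^ a * MvPolynomial.X 1 ^ b))).congr fun x _ => ?_
  simp only [Pi.mul_apply, map_mul, map_pow, MvPolynomial.aeval_X]
  ring

/-- **Absolute convergence of the level-one monomial integrand with a real coefficient**:
`c·x₀^a x₁^b/(1 − x₀x₁)` is integrable on the open unit box (the constant factors out of seat c7's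
`integrableOn_aeval_div_one_sub_mul`, Beukers' integral for `ζ(2)`).
[cite: KontsevichZagier2001, §1.1] -/
theorem integrableOn_monomialBoxIntegrandA (a b : ℕ) (c : ℝ) :
    IntegrableOn (fun x : Fin 2 → ℝ => c * (x 0 ^ a * x 1 ^ b) / (1 - x 0 * x 1))
      {x | ∀ i, x i ∈ Set.Ioo (0:ℝ) 1} := by
  have h := (LevelOne.integrableOn_aeval_div_one_sub_mul
    (MvPolynomial.X 0 ^ a * MvPolynomial.X 1 ^ b)).const_mul c
  have e : (fun x : Fin 2 → ℝ => c * (x 0 ^ a * x 1 ^ b) / (1 - x 0 * x 1)) =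
      fun x : Fin 2 → ℝ => c * ((MvPolynomial.aeval x
        (MvPolynomial.X 0 ^ a * MvPolynomial.X 1 ^ b : MvPolynomial (Fin 2) ℚ) : ℝ) /
          (1 - x 0 * x 1)) := by
    funext x
    simp only [map_mul, map_pow, MvPolynomial.aeval_X]
    ring
  rw [e]
  exact h

/-- **The level-one monomial box with an algebraic coefficient exists**:
`[(0,1)², c·x₀^a x₁^b/(1 − x₀x₁)]` is an integral representation for real algebraic `c`.
[cite: KontsevichZagier2001, §1.1] -/
theorem exists_monomialBoxRepA (a b : ℕ) {c : ℝ} (hc : IsAlgebraic ℚ c) :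
    ∃ N : IntegralRep 2, N.domain = {x | ∀ i, x i ∈ Set.Ioo (0:ℝ) 1} ∧
      N.integrand = fun x => c * (x 0 ^ a * x 1 ^ b) / (1 - x 0 * x 1) :=
  ⟨⟨_, _, isSemialgebraic_box 2, isSemialgebraicFunOn_monomialBoxIntegrandA a b hc,
    integrableOn_monomialBoxIntegrandA a b c⟩, rfl, rfl⟩

/-! ## The triangle -/

/-- **Semialgebraicity of the triangle integrand with an algebraic coefficient.**
`z ↦ c·z₀^{a−b−1} z₁^b/(1 − z₁)` is `ℚ`-semialgebraic on the triangle `{0 < z₀ < 1, 0 ≤ z₁ ≤ z₀}`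
for real algebraic `c` (constant times seat c7's rational integrand with `c = 1`).
[cite: KontsevichZagier2001, §1.1] -/
theorem isSemialgebraicFunOn_triangleIntegrandA (a b : ℕ) {c : ℝ} (hc : IsAlgebraic ℚ c) :
    IsSemialgebraicFunOn ℚ
      (KZlog.band {y : Fin 1 → ℝ | 0 < y 0 ∧ y 0 < 1} (fun _ => (0:ℝ)) (fun y => y 0))
      (fun z => c * (z 0 ^ (a - b - 1) * z 1 ^ b) / (1 - z 1)) := by
  refine (IsSemialgebraicFunOn.mul_holds
    (isSemialgebraicFunOn_const_of_isAlgebraic LevelOne.isSemialgebraic_triangleBand hc)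
    (LevelOne.isSemialgebraicFunOn_triangleIntegrand a b 1)).congr fun z _ => ?_
  simp only [Pi.mul_apply, Rat.cast_one, one_mul]
  ring

/-- **Absolute convergence of the triangle integrand with a real coefficient**:
`c·z₀^{a−b−1} z₁^b/(1 − z₁)` is integrable on the triangle (the constant factors out of seat c7's
`integrableOn_triangleIntegrand`, itself obtained by transporting Beukers' integral through the
merge chart `(x₀, x₁) ↦ (x₀, x₀x₁)`). [cite: KontsevichZagier2001, §1.2] -/
theorem integrableOn_triangleIntegrandA (a b : ℕ) (c : ℝ) :
    IntegrableOn (fun z : Fin 2 → ℝ => c * (z 0 ^ (a - b - 1) * z 1 ^ b) / (1 - z 1))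
      (KZlog.band {y : Fin 1 → ℝ | 0 < y 0 ∧ y 0 < 1} (fun _ => (0:ℝ)) (fun y => y 0)) := by
  have h := (LevelOne.integrableOn_triangleIntegrand a b 1).const_mul c
  have e : (fun z : Fin 2 → ℝ => c * (z 0 ^ (a - b - 1) * z 1 ^ b) / (1 - z 1)) =
      fun z : Fin 2 → ℝ => c * (((1 : ℚ) : ℝ) * (z 0 ^ (a - b - 1) * z 1 ^ b) / (1 - z 1)) := by
    funext z
    rw [Rat.cast_one, one_mul, mul_div_assoc]
  rw [e]
  exact h

/-- **The triangle representation with an algebraic coefficient exists**: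
`[{0 < z₀ < 1, 0 ≤ z₁ ≤ z₀}, c·z₀^{a−b−1} z₁^b/(1 − z₁)]` is an integral representation for real
algebraic `c` — the image of the box monomial `c·x₀^a x₁^b/(1 − x₀x₁)` (`a > b`) under the merge
gadget. [cite: KontsevichZagier2001, §1.2] -/
theorem exists_triangleRepA (a b : ℕ) {c : ℝ} (hc : IsAlgebraic ℚ c) :
    ∃ R : IntegralRep 2,
      R.domain = KZlog.band {y : Fin 1 → ℝ | 0 < y 0 ∧ y 0 < 1} (fun _ => (0:ℝ)) (fun y => y 0) ∧
      R.integrand = fun z => c * (z 0 ^ (a - b - 1) * z 1 ^ b) / (1 - z 1) :=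
  ⟨⟨_, _, LevelOne.isSemialgebraic_triangleBand, isSemialgebraicFunOn_triangleIntegrandA a b hc,
    integrableOn_triangleIntegrandA a b c⟩, rfl, rfl⟩

/-! ## Polynomial boxes -/

/-- **The dimension-one polynomial box with an algebraic coefficient exists**:
`[(0,1), (c/k)·x₀^b Σ_{i<k} x₀^i]` is an integral representation for real algebraic `c` (the
constant `c/k` is algebraic; the polynomial integrand is continuous on the compact cube
`[0,1] ⊇ (0,1)`). [cite: KontsevichZagier2001, §1.1] -/
theorem exists_dimOnePolyRepA (b k : ℕ) {c : ℝ} (hc : IsAlgebraic ℚ c) :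
    ∃ N₁ : IntegralRep 1, N₁.domain = {x | ∀ i, x i ∈ Set.Ioo (0:ℝ) 1} ∧
      N₁.integrand = fun x => c / (k : ℝ) * (x 0 ^ b * ∑ i ∈ Finset.range k, x 0 ^ i) := by
  have hB := isSemialgebraic_box 1
  have hck : IsAlgebraic ℚ (c / (k : ℝ)) := by
    rw [div_eq_mul_inv]
    exact hc.mul (isAlgebraic_nat k).inv
  have hsa : IsSemialgebraicFunOn ℚ {x : Fin 1 → ℝ | ∀ i, x i ∈ Set.Ioo (0:ℝ) 1}
      (fun x => c / (k : ℝ) * (x 0 ^ b * ∑ i ∈ Finset.range k, x 0 ^ i)) := by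
    refine (IsSemialgebraicFunOn.mul_holds (isSemialgebraicFunOn_const_of_isAlgebraic hB hck)
      (isSemialgebraicFunOn_aeval hB
        (MvPolynomial.X 0 ^ b * ∑ i ∈ Finset.range k, MvPolynomial.X 0 ^ i))).congr fun x _ => ?_
    simp only [Pi.mul_apply, map_mul, map_pow, map_sum, MvPolynomial.aeval_X]
  have hcont : Continuous fun x : Fin 1 → ℝ =>
      c / (k : ℝ) * (x 0 ^ b * ∑ i ∈ Finset.range k, x 0 ^ i) := by
    fun_prop
  have hint : IntegrableOn
      (fun x : Fin 1 → ℝ => c / (k : ℝ) * (x 0 ^ b * ∑ i ∈ Finset.range k, x 0 ^ i))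
      {x | ∀ i, x i ∈ Set.Ioo (0:ℝ) 1} :=
    hcont.integrableOn_Icc.mono_set fun _ hx => ⟨fun j => (hx j).1.le, fun j => (hx j).2.le⟩
  exact ⟨⟨_, _, hB, hsa, hint⟩, rfl, rfl⟩

/-- **The diagonal monomial box with an algebraic coefficient exists**: `[(0,1)², c·(x₀x₁)^i]` is
an integral representation for real algebraic `c` (polynomial integrand, continuous on `[0,1]²`).
[cite: KontsevichZagier2001, §1.1] -/
theorem exists_diagMonomialRepA (i : ℕ) {c : ℝ} (hc : IsAlgebraic ℚ c) :
    ∃ M : IntegralRep 2, M.domain = {x | ∀ i, x i ∈ Set.Ioo (0:ℝ) 1} ∧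
      M.integrand = fun x => c * (x 0 * x 1) ^ i := by
  have hB := isSemialgebraic_box 2
  have hsa : IsSemialgebraicFunOn ℚ {x : Fin 2 → ℝ | ∀ i, x i ∈ Set.Ioo (0:ℝ) 1}
      (fun x => c * (x 0 * x 1) ^ i) := by
    refine (IsSemialgebraicFunOn.mul_holds (isSemialgebraicFunOn_const_of_isAlgebraic hB hc)
      (isSemialgebraicFunOn_aeval hB
        ((MvPolynomial.X 0 * MvPolynomial.X 1) ^ i))).congr fun x _ => ?_
    simp only [Pi.mul_apply, map_mul, map_pow, MvPolynomial.aeval_X]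
  have hcont : Continuous fun x : Fin 2 → ℝ => c * (x 0 * x 1) ^ i := by fun_prop
  have hint : IntegrableOn (fun x : Fin 2 → ℝ => c * (x 0 * x 1) ^ i)
      {x | ∀ i, x i ∈ Set.Ioo (0:ℝ) 1} :=
    hcont.integrableOn_Icc.mono_set LevelOne.box_two_subset_Icc
  exact ⟨⟨_, _, hB, hsa, hint⟩, rfl, rfl⟩

/-! ## The registered sub-goal -/

/-- **Stub A4 (existence of the representations of the algebraic level-one pipeline; registered
sub-goal `alg_exists_reps` of stmt-KontsevichZagierPeriods-3869).** For a real algebraic coefficient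
`c`, the level-one monomial box `[(0,1)², c·x₀^a x₁^b/(1 − x₀x₁)]`, the triangle
`[{0 < z₀ < 1, 0 ≤ z₁ ≤ z₀}, c·z₀^{a−b−1} z₁^b/(1 − z₁)]`, the dimension-one polynomial box
`[(0,1), (c/k)·x₀^b Σ_{i<k} x₀^i]`, the diagonal monomial box `[(0,1)², c·(x₀x₁)^i]` and the point
`[pt, c]` all exist as integral representations of the Kontsevich–Zagier calculus, with literally
these domains and integrands (the point is `Dlog.exists_ptCarrierA` at `c`).
[cite: KontsevichZagier2001, §1.1] -/
theorem alg_exists_reps (c : ℝ) (hc : IsAlgebraic ℚ c) :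
    (∀ (a b : ℕ), ∃ N : IntegralRep 2, N.domain = {x | ∀ i, x i ∈ Set.Ioo (0:ℝ) 1} ∧
      N.integrand = fun x => c * (x 0 ^ a * x 1 ^ b) / (1 - x 0 * x 1)) ∧
    (∀ (a b : ℕ), b < a → ∃ R : IntegralRep 2,
      R.domain = KZlog.band {y : Fin 1 → ℝ | 0 < y 0 ∧ y 0 < 1} (fun _ => (0:ℝ)) (fun y => y 0) ∧
      R.integrand = fun z => c * (z 0 ^ (a - b - 1) * z 1 ^ b) / (1 - z 1)) ∧
    (∀ (b k : ℕ), ∃ N₁ : IntegralRep 1, N₁.domain = {x | ∀ i, x i ∈ Set.Ioo (0:ℝ) 1} ∧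
      N₁.integrand = fun x => c / (k : ℝ) * (x 0 ^ b * ∑ i ∈ Finset.range k, x 0 ^ i)) ∧
    (∀ (i : ℕ), ∃ M : IntegralRep 2, M.domain = {x | ∀ i, x i ∈ Set.Ioo (0:ℝ) 1} ∧
      M.integrand = fun x => c * (x 0 * x 1) ^ i) ∧
    (∃ Z : IntegralRep 0, Z.domain = Set.univ ∧ Z.integrand = fun _ => c) := by
  obtain ⟨Zf, hZf⟩ := Dlog.exists_ptCarrierA
  exact ⟨fun a b => exists_monomialBoxRepA a b hc, fun a b _ => exists_triangleRepA a b hc,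
    fun b k => exists_dimOnePolyRepA b k hc, fun i => exists_diagMonomialRepA i hc,
    Zf c, (hZf c hc).1, (hZf c hc).2⟩

end Summit.KontsevichZagierPeriods.HurwitzMicroSectors.NormalFormPrinciple.PiBox.AlgLevelOne
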